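import Mathlib
import Summits.ResolutionOfSingularities.ResolutionOfSingularities.Theorems.WeightedInvariantLocalWeightedDropNCResRegimeDefs
import Summits.ResolutionOfSingularities.ResolutionOfSingularities.Theorems.WeightedInvariantLocalWeightedDropTOT2BridgePresentedEntry

/-!
# `WeightedInvariant.LocalWeightedDrop`, TOT2-LINE v1.3 piece (P1) in the registrar's vocabulary: **THE STRAIGHT PRESENTATION OF A STATE OF THE
# REGIME `stub_regimePresented`** (`¬ HCol` and `O ≠ ∅ ∨ GoodDir`)

Crux item stmt-ResolutionOfSingularities-8899 `LocalWeightedDrop` (route `ResolutionOfSingularities/WeightedInvariant`), ENGINE skeleton v33 (candidate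
35b29332b4d99231), stub `stub_regimePresented : … Admissible b δ → 2 ≤ δ.o → ¬ δ.HCol → (δ.O.Nonempty ∨ δ.GoodDir) → DWinsTo …`; TOT2-LINE v1.3 §3 (P1)
(res-L1-w43-lead-1 g5, 15:24Z WANT).  [OURS · L1 W4.3 · chain w43 · stub worker res-L1-w43-stub-2 (gen 5); wrappers of …TOT2BridgePresentedEntry /
…TOT2BridgeOldLetterEntry over res-L1-w43-lead-1's …NCResRegimeDefs (`Decoration.IsDirForm / GoodDir / HCol`, `exists_isDirForm_of_not_hCol`, p542423).
Nothing here is a statement of any manuscript; AI-produced, gate-checked, weaker than expert review.  Definition-free.]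

* `Decoration.exists_O_eq_singleton_of_isDirForm` — a directrix form and `O ≠ ∅` ⇒ `O = {l₀}`;
* `Decoration.isDirForm_single_of_O_eq_singleton` — then the directrix IS the old letter (`IsDirForm (e_{l₀})`);
* `Decoration.exists_straightPresentation_of_isDirForm_of_O_nonempty` / `…_of_goodDir` — the two cases in the WANT shape;
* **`Decoration.exists_straightPresentation_of_presented`** — (three letters, `k` infinite) the hypotheses of `stub_regimePresented` VERBATIM
  (`Admissible b δ`, `2 ≤ δ.o`, `¬ δ.HCol`, `δ.O.Nonempty ∨ δ.GoodDir`) ⇒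
  `∃ Θ H A, (∀ i, constantCoeff (Θ i) = 0) ∧ IsUnit (linMat Θ).det ∧ (∀ l ∈ E, ∃ l' u, u(0) ≠ 0 ∧ Θ l = u · X l') ∧ H(0) ≠ 0 ∧ IsPosT-shape ∧
  subst Θ (f · ∏_O x) = H · monicForm δ.c A` — the ENTRY of the regime (P).
-/

set_option linter.dupNamespace false -- mandated namespace of this single-conjunct summit

noncomputable section

namespace Summit.ResolutionOfSingularities.ResolutionOfSingularities.Theorems

namespace TameFourTupleDrop

namespace Decoration

open MvPowerSeries Literature.AlgebraicGeometry.Resolution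

variable {k : Type} [Field k] {m : ℕ}

/-- **`O ≠ ∅` ⇒ EXACTLY ONE OLD LETTER** under a directrix form (`|O| ≤ 1`: distinct letters cannot both divide `ℓ^c`). -/
theorem exists_O_eq_singleton_of_isDirForm {δ : Decoration k m} {ℓ : Fin (m + 1) → k} (hℓ : δ.IsDirForm ℓ) (hO : δ.O.Nonempty) :
    ∃ l, δ.O = {l} := by
  obtain ⟨hℓ0, la, hla, hcone⟩ := hℓ
  rcases O_eq_empty_or_singleton_of_linearCone hla hℓ0 hcone with h | h
  · exact absurd h hO.ne_empty
  · exact h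

/-- **THE DIRECTRIX IS THE OLD LETTER**: with `O = {l₀}`, every directrix form is along `x_{l₀}`, i.e. `IsDirForm (e_{l₀})`. -/
theorem isDirForm_single_of_O_eq_singleton {δ : Decoration k m} {ℓ : Fin (m + 1) → k} (hℓ : δ.IsDirForm ℓ) {l₀ : Fin (m + 1)}
    (hO : δ.O = {l₀}) : δ.IsDirForm (Pi.single l₀ 1) := by
  have hℓ' := hℓ
  obtain ⟨-, la, hla, hcone⟩ := hℓ'
  obtain ⟨hprod, hc⟩ := prod_O_eq_of_eq_singleton hO
  refine isDirForm_single_of_support hℓ fun j hj => ?_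
  refine apply_eq_zero_of_cone_mul_X δ.f l₀ δ.o hla ℓ (fun v => ?_) hj
  have h := hcone v
  rwa [hprod, hc] at h

/-- (P1), case `O ≠ ∅`, from a directrix form (`k` infinite): the swap presentation in the WANT shape, with `A 0 = 0`. -/
theorem exists_straightPresentation_of_isDirForm_of_O_nonempty [Infinite k] {b : MvPowerSeries (Fin (m + 1)) k} {δ : Decoration k m}
    (hadm : Admissible b δ) {ℓ : Fin (m + 1) → k} (hℓ : δ.IsDirForm ℓ) (hO : δ.O.Nonempty) :
    ∃ (Θ : Fin (m + 1) → MvPowerSeries (Fin (m + 1)) k) (H : MvPowerSeries (Fin (m + 1)) k) (A : Fin δ.c → MvPowerSeries (Fin m) k),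
      (∀ i, constantCoeff (Θ i) = 0) ∧ IsUnit (FormalCoordChange.linMat Θ).det ∧
      (∀ l ∈ δ.E, ∃ (l' : Fin (m + 1)) (u : MvPowerSeries (Fin (m + 1)) k), constantCoeff u ≠ 0 ∧ Θ l = u * X l') ∧
      constantCoeff H ≠ 0 ∧ (∀ j : Fin δ.c, ((δ.c - (j : ℕ) : ℕ) : ℕ∞) < (A j).order) ∧ (∀ h0 : 0 < δ.c, A ⟨0, h0⟩ = 0) ∧
      subst Θ (δ.f * ∏ l' ∈ δ.O, X l') =
        H * (X (Fin.last m) ^ δ.c + ∑ j : Fin δ.c, rename (Fin.succAboveEmb (Fin.last m)) (A j) * X (Fin.last m) ^ (j : ℕ)) := by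
  obtain ⟨l₀, hOl⟩ := exists_O_eq_singleton_of_isDirForm hℓ hO
  obtain ⟨hℓ0, la, hla, hcone⟩ := hℓ
  exact exists_straightPresentation_of_O_eq_singleton hadm.2.1.ne_zero hOl hla hℓ0 hcone

/-- (P1), case `GoodDir` (`k` infinite): the swap-and-row-operation presentation in the WANT shape. -/
theorem exists_straightPresentation_of_goodDir' [Infinite k] {b : MvPowerSeries (Fin (m + 1)) k} {δ : Decoration k m}
    (hadm : Admissible b δ) (hgood : δ.GoodDir) :
    ∃ (Θ : Fin (m + 1) → MvPowerSeries (Fin (m + 1)) k) (H : MvPowerSeries (Fin (m + 1)) k) (A : Fin δ.c → MvPowerSeries (Fin m) k),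
      (∀ i, constantCoeff (Θ i) = 0) ∧ IsUnit (FormalCoordChange.linMat Θ).det ∧
      (∀ l ∈ δ.E, ∃ (l' : Fin (m + 1)) (u : MvPowerSeries (Fin (m + 1)) k), constantCoeff u ≠ 0 ∧ Θ l = u * X l') ∧
      constantCoeff H ≠ 0 ∧ (∀ j : Fin δ.c, ((δ.c - (j : ℕ) : ℕ) : ℕ∞) < (A j).order) ∧
      subst Θ (δ.f * ∏ l' ∈ δ.O, X l') =
        H * (X (Fin.last m) ^ δ.c + ∑ j : Fin δ.c, rename (Fin.succAboveEmb (Fin.last m)) (A j) * X (Fin.last m) ^ (j : ℕ)) := by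
  obtain ⟨hO, ℓ, ⟨-, la, hla, hcone⟩, j, hjE, hj⟩ := hgood
  exact exists_straightPresentation_of_goodDir hadm.2.1.ne_zero hO hla hcone hjE hj

/-- **(P1) THE ENTRY OF THE REGIME `stub_regimePresented`** (three letters, `k` infinite; the registrar's hypotheses verbatim): an admissible state with
`2 ≤ o`, outside the apex column, with `O ≠ ∅` or in good position, has a STRAIGHT PRESENTATION — a legal `Θ` (zero constants, invertible linear part)
mapping every boundary letter to (a unit times) a letter, a unit `H` and a position `A` of degree `c` with `(f · ∏_{l∈O} x_l) ∘ Θ = H · (y^c + Σ A_j y^j)`. -/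
theorem exists_straightPresentation_of_presented [Infinite k] {b : MvPowerSeries (Fin (2 + 1)) k} {δ : Decoration k 2}
    (hadm : Admissible b δ) (ho : 2 ≤ δ.o) (hnot : ¬ δ.HCol) (h : δ.O.Nonempty ∨ δ.GoodDir) :
    ∃ (Θ : Fin (2 + 1) → MvPowerSeries (Fin (2 + 1)) k) (H : MvPowerSeries (Fin (2 + 1)) k) (A : Fin δ.c → MvPowerSeries (Fin 2) k),
      (∀ i, constantCoeff (Θ i) = 0) ∧ IsUnit (FormalCoordChange.linMat Θ).det ∧
      (∀ l ∈ δ.E, ∃ (l' : Fin (2 + 1)) (u : MvPowerSeries (Fin (2 + 1)) k), constantCoeff u ≠ 0 ∧ Θ l = u * X l') ∧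
      constantCoeff H ≠ 0 ∧ (∀ j : Fin δ.c, ((δ.c - (j : ℕ) : ℕ) : ℕ∞) < (A j).order) ∧
      subst Θ (δ.f * ∏ l' ∈ δ.O, X l') =
        H * (X (Fin.last 2) ^ δ.c + ∑ j : Fin δ.c, rename (Fin.succAboveEmb (Fin.last 2)) (A j) * X (Fin.last 2) ^ (j : ℕ)) := by
  rcases h with hO | hgood
  · obtain ⟨ℓ, hℓ⟩ := exists_isDirForm_of_not_hCol hadm ho hnot
    obtain ⟨Θ, H, A, h0, hdet, hP3, hH, hA, -, hP⟩ := exists_straightPresentation_of_isDirForm_of_O_nonempty hadm hℓ hO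
    exact ⟨Θ, H, A, h0, hdet, hP3, hH, hA, hP⟩
  · exact exists_straightPresentation_of_goodDir' hadm hgood

end Decoration

end TameFourTupleDrop

end Summit.ResolutionOfSingularities.ResolutionOfSingularities.Theorems

end
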